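import Literature.IUT.LogVolume.RArithmeticDivisorsPullback
import Mathlib.NumberTheory.NumberField.ProductFormula
import Mathlib.NumberTheory.RamificationInertia.Valuation
import HarnessLib

/-!
# [GenEll] §1 (p. 4): principal arithmetic divisors, the subgroup `APrc(F)`, and the degree map on
# `ADiv(F)/APrc(F)` — the product formula

S. Mochizuki, *Arithmetic elliptic curves in general position*, Math. J. Okayama Univ. **52** (2010),
§1 "Generalities on Heights", journal p. 4, read on the page (corpus `paper:doi-10-18926-mjou-33503`,
p. 4):

"Let `F` be a number field [i.e., a finite extension of the rational number field `ℚ`], whose ring of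
integers we denote by `O_F`, and whose set of valuations we denote by `𝕍(F)`. Thus, `𝕍(F)` decomposes
as a disjoint union `𝕍(F) = 𝕍(F)^non ∪ 𝕍(F)^arc` of nonarchimedean and archimedean valuations. If
`v ∈ 𝕍(F)`, then we shall write `F_v` for the completion of `F` at `v` and `|−|_v : F_v → ℝ` for the
real-valued valuation map determined by `v`. If `v ∈ 𝕍(F)^non`, then we shall write
`ord_v(−) : F_v → ℤ` for the order defined by `v` and `q_v` for the cardinality of the residue field of
`F_v`. An arithmetic divisor on `F` is defined to be a finite formal sum `Σ_{v ∈ 𝕍(F)} c_v · v` — where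
`c_v ∈ ℤ` if `v ∈ 𝕍(F)^non` and `c_v ∈ ℝ` if `v ∈ 𝕍(F)^arc` … Thus, the arithmetic divisors on `F`
naturally form a group `ADiv(F)`. If `f ∈ F`, then the assignment
`f ↦ ADiv(f) := Σ_{v ∈ 𝕍(F)^non} ord_v(f) · v − Σ_{v ∈ 𝕍(F)^arc} [F_v : ℝ] · log(|f|_v) · v`
[where `log` denotes the natural logarithm] determines an element `∈ ADiv(F)`, which we shall refer to
as the principal arithmetic divisor associated to `f`. Thus, the principal arithmetic divisors
determine a subgroup `APrc(F) ⊆ ADiv(F)`. Moreover, as is well-known, there is a natural isomorphism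
`ADiv(F)/APrc(F) ⥲ APic(Spec(O_F))` — cf. [14], Proposition 1.1. In particular, the degree map
`deg_F : ADiv(F)/APrc(F) → ℝ` defined by sending `𝕍(F)^non ∋ v ↦ log(q_v)`; `𝕍(F)^arc ∋ v ↦ 1`
[cf. [14], §1.1] determines a homomorphism `APic(Spec(O_F)) → ℝ`, which we shall also denote by
`deg_F`."

## Rendering (Mathlib + the tree; nothing but the printed objects)

We work inside the `ℝ`-arithmetic divisors `ADiv_ℝ(F) = ADivisor F = Place F →₀ ℝ` of
`RArithmeticDivisors` ([IUTchIV] Def. 1.9 (i): the same places `Place F = 𝕍(F)^arc ⊕ 𝕍(F)^non =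
NumberField.InfinitePlace F ⊕ HeightOneSpectrum (𝓞 F)`, the same degree map `degF` with weights
`log(q_v)` / `1`), which contains [GenEll]'s `ADiv(F)`. Ingredients: `ord_v` = the tree's `ord F v`
(`ArakelovDivisors`, junk `ord_v(0) = 0`), `log(q_v)` = `logNorm F v`, `|f|_v` at an archimedean `v` =
Mathlib's `(v : InfinitePlace F) f` and `[F_v : ℝ] = v.mult ∈ {1, 2}` (as in `RArithmeticDivisors`).

* `ADivisor.principal f = ADiv(f)` (`principal_apply_inl/_inr`; junk `ADiv(0) = 0`); it IS a finite
  formal sum because only finitely many `v` have `ord_v(f) ≠ 0` (`finite_setOf_ord_ne_zero`, from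
  Mathlib's `FinitePlace.hasFiniteMulSupport`).
* `principal_one/_mul/_inv`: `f ↦ ADiv(f)` is a homomorphism on `F^×` (`principalHom`); its image is
  the subgroup `APrc F` ("the principal arithmetic divisors determine a subgroup").
* **`degF_principal : deg_F(ADiv(f)) = 0`** — the content of "`deg_F : ADiv(F)/APrc(F) → ℝ` …
  determines a homomorphism" = the PRODUCT FORMULA `∏_{v|∞} |f|_v^{[F_v:ℝ]} · ∏_{v∤∞} q_v^{−ord_v(f)} = 1`
  (Mathlib `NumberField.prod_abs_eq_one`), in the log form `sum_mult_log_add_sum_log_adicAbv_eq_zero` /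
  `sum_ord_mul_logNorm_eq_sum_mult_log`; hence `degF` kills `APrc F` and DESCENDS to
  `degFQuot : ADivisor F ⧸ APrc F →+ ℝ` (`degFQuot_mk`), and `degF_add_principal` (degrees — hence
  heights — only depend on the class modulo principal divisors).
* `pullback_principal : ADiv(f)|_K = ADiv(f)` for a finite extension `K/F` (with the pull-back `𝔞|_K`
  of `RArithmeticDivisorsPullback`: `ord_w(f) = e_{w|v}·ord_v(f)`, Mathlib `valuation_liesOver`, and
  `[K_w:ℝ] = [K_w:F_v]·[F_v:ℝ]`), so `APrc(F)|_K ⊆ APrc(K)` (`pullback_mem_APrc`) — the compatibility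
  behind p. 5 "for any finite extension `K` of `F` … `deg_K(L|_{Spec(O_K)}) = deg_F(L)`" on classes.

RELATED (same classical content, other vocabulary): the Frobenioid-side file
`Literature/AlgebraicGeometry/Frobenioids/ArithmeticDivisors.lean` ([FrdI] Ex. 6.3) types
`ArithDivisor F = (FinitePlace F →₀ ℤ) × (InfinitePlace F → ℝ)` with `principalArithDivisor`,
`arithDegree` and proves `arithDegree_principalArithDivisor` (product formula) there. THIS file is the
[GenEll] §1 / [IUTchIV] Def. 1.9 rendering inside `ADiv_ℝ(F) = ADivisor F` — the group the LogVolume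
chain computes in (`degF`/`ndeg`, `pullback`, `FinDivisor` bridge, `qDivisor` of Cor. 2.2) — and adds
what that chain needs: `APrc`, the degree on the quotient, `degF_add_principal`, and the pull-back
compatibility `pullback_principal`; the identification `ArithDivisor F → ADivisor F` of the two
renderings is `TODO` (bridge file). `TODO(general form)`: [GenEll]'s `ADiv(F)` has INTEGER
coefficients at the finite places (we realise `ADiv(f)` in `ADiv_ℝ(F) ⊇ ADiv(F)` and record
integrality as `principal_apply_inr`); the isomorphism `ADiv(F)/APrc(F) ⥲ APic(Spec(O_F))` with
metrised line bundles ([14] = L. Szpiro, *Degrés, intersections, hauteurs*, Astérisque 127 (1985),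
Prop. 1.1) is not typed.
Classical algebraic number theory; no statement of the disputed corpus is involved.
[cite: MochizukiGenEll2010, §1 p.4]
-/

noncomputable section

namespace Literature.IUT.LogVolume

open NumberField IsDedekindDomain Finset

variable (F : Type*) [Field F] [NumberField F]

/-! ### Only finitely many finite places see a given `f ∈ F^×` -/

/-- `ord_v(f) ≠ 0 ↔ ‖f‖_v ≠ 1` for `f ≠ 0` (`‖f‖_v = q_v^{−ord_v(f)}`, `q_v > 1`).
[cite: MochizukiGenEll2010, §1 p.4] -/
theorem ord_ne_zero_iff_adicAbv_ne_one (v : HeightOneSpectrum (𝓞 F)) {f : F} (hf : f ≠ 0) :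
    ord F v f ≠ 0 ↔ NumberField.HeightOneSpectrum.adicAbv F v f ≠ 1 := by
  have h1 : (1 : ℝ) < (Ideal.absNorm v.asIdeal : ℝ) := by
    exact_mod_cast NumberField.HeightOneSpectrum.one_lt_absNorm v
  rw [adicAbv_eq_absNorm_zpow F v hf, ne_eq, ne_eq,
    zpow_eq_one_iff_right₀ (zero_le_one.trans h1.le) h1.ne', neg_eq_zero]

/-- "finite formal sum": for `f ∈ F` only finitely many `v ∈ 𝕍(F)^non` have `ord_v(f) ≠ 0` (for
`f = 0` the set is empty by the junk convention `ord_v(0) = 0`). [cite: MochizukiGenEll2010, §1 p.4] -/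
theorem finite_setOf_ord_ne_zero (f : F) : {v : HeightOneSpectrum (𝓞 F) | ord F v f ≠ 0}.Finite := by
  by_cases hf : f = 0
  · simp [hf, ord_zero]
  · have h : (Function.mulSupport fun w : FinitePlace F => w f).Finite :=
      FinitePlace.hasFiniteMulSupport hf
    have hset : {v : HeightOneSpectrum (𝓞 F) | ord F v f ≠ 0} =
        FinitePlace.mk ⁻¹' (Function.mulSupport fun w : FinitePlace F => w f) := by
      ext v
      simp only [Set.mem_setOf_eq, Set.mem_preimage, Function.mem_mulSupport,
        FinitePlace.mk_apply, FinitePlace.norm_embedding]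
      exact ord_ne_zero_iff_adicAbv_ne_one F v hf
    rw [hset]
    exact h.preimage fun a _ b _ hab => FinitePlace.mk_eq_iff.mp hab

namespace ADivisor

variable {F}

/-! ### The principal arithmetic divisor `ADiv(f)` -/

/-- The archimedean part of `ADiv(f)`: `𝕍(F)^arc ∋ v ↦ −[F_v : ℝ]·log(|f|_v)` (`[F_v:ℝ] = v.mult`,
`|f|_v = v f`). [cite: MochizukiGenEll2010, §1 p.4] -/
def principalArc (f : F) : InfinitePlace F →₀ ℝ :=
  Finsupp.equivFunOnFinite.symm fun w => -((w.mult : ℝ) * Real.log (w f))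

/-- The nonarchimedean part of `ADiv(f)`: `𝕍(F)^non ∋ v ↦ ord_v(f)` (finitely supported by
`finite_setOf_ord_ne_zero`). [cite: MochizukiGenEll2010, §1 p.4] -/
def principalNon (f : F) : HeightOneSpectrum (𝓞 F) →₀ ℝ :=
  Finsupp.ofSupportFinite (fun v => (ord F v f : ℝ))
    (by simpa [Function.support] using finite_setOf_ord_ne_zero F f)

/-- **The principal arithmetic divisor** `ADiv(f) = Σ_{v ∈ 𝕍(F)^non} ord_v(f)·v −
Σ_{v ∈ 𝕍(F)^arc} [F_v:ℝ]·log(|f|_v)·v`, as an element of `ADiv_ℝ(F) = Place F →₀ ℝ` (junk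
`ADiv(0) = 0`). [cite: MochizukiGenEll2010, §1 p.4] -/
def principal (f : F) : ADivisor F := (principalArc f).sumElim (principalNon f)

/-- Coefficient of `ADiv(f)` at an archimedean `v`: `−[F_v:ℝ]·log(|f|_v)`.
[cite: MochizukiGenEll2010, §1 p.4] -/
@[simp] theorem principal_apply_inl (f : F) (w : InfinitePlace F) :
    principal f (Sum.inl w) = -((w.mult : ℝ) * Real.log (w f)) := rfl

/-- Coefficient of `ADiv(f)` at a nonarchimedean `v`: the INTEGER `ord_v(f)` (so `ADiv(f)` lies in
[GenEll]'s `ADiv(F) ⊆ ADiv_ℝ(F)`). [cite: MochizukiGenEll2010, §1 p.4] -/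
@[simp] theorem principal_apply_inr (f : F) (v : HeightOneSpectrum (𝓞 F)) :
    principal f (Sum.inr v) = (ord F v f : ℝ) := rfl

/-- For an algebraic integer `f` the finite coefficients of `ADiv(f)` are `≥ 0`.
[cite: MochizukiGenEll2010, §1 p.4] -/
theorem principal_apply_inr_nonneg (f : 𝓞 F) (v : HeightOneSpectrum (𝓞 F)) :
    0 ≤ principal (f : F) (Sum.inr v) := by
  rw [principal_apply_inr]
  exact_mod_cast ord_nonneg_of_isIntegral F v f

/-- Junk value: `ADiv(0) = 0` (`ord_v(0) = 0`, `log 0 = 0`). [cite: MochizukiGenEll2010, §1 p.4] -/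
@[simp] theorem principal_zero : principal (0 : F) = 0 := by
  ext (w | v)
  · simp
  · simp [ord_zero]

/-- `ADiv(1) = 0`. [cite: MochizukiGenEll2010, §1 p.4] -/
@[simp] theorem principal_one : principal (1 : F) = 0 := by
  ext (w | v)
  · simp
  · simp [ord_one]

/-- `ADiv(fg) = ADiv(f) + ADiv(g)` for `f, g ≠ 0` (`ord_v` and `log|−|_v` are additive).
[cite: MochizukiGenEll2010, §1 p.4] -/
theorem principal_mul {f g : F} (hf : f ≠ 0) (hg : g ≠ 0) :
    principal (f * g) = principal f + principal g := by
  ext (w | v)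
  · have hf' : (w f : ℝ) ≠ 0 := (InfinitePlace.pos_iff.mpr hf).ne'
    have hg' : (w g : ℝ) ≠ 0 := (InfinitePlace.pos_iff.mpr hg).ne'
    simp only [principal_apply_inl, map_mul, Finsupp.add_apply, Real.log_mul hf' hg']
    ring
  · simp only [principal_apply_inr, ord_mul F v hf hg, Finsupp.add_apply]
    push_cast
    ring

/-- `ADiv(f⁻¹) = −ADiv(f)`. [cite: MochizukiGenEll2010, §1 p.4] -/
theorem principal_inv (f : F) : principal f⁻¹ = -principal f := by
  ext (w | v)
  · simp only [principal_apply_inl, map_inv₀, Real.log_inv, Finsupp.neg_apply]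
    ring
  · simp only [principal_apply_inr, ord_inv, Finsupp.neg_apply]
    push_cast
    ring

/-- `ADiv(f/g) = ADiv(f) − ADiv(g)` for `f, g ≠ 0`. [cite: MochizukiGenEll2010, §1 p.4] -/
theorem principal_div {f g : F} (hf : f ≠ 0) (hg : g ≠ 0) :
    principal (f / g) = principal f - principal g := by
  rw [div_eq_mul_inv, principal_mul hf (inv_ne_zero hg), principal_inv, sub_eq_add_neg]

/-- `f ↦ ADiv(f)` as a homomorphism `F^× → ADiv_ℝ(F)` (written multiplicatively on the target).
[cite: MochizukiGenEll2010, §1 p.4] -/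
def principalHom : Fˣ →* Multiplicative (ADivisor F) where
  toFun u := Multiplicative.ofAdd (principal (u : F))
  map_one' := by simp
  map_mul' u u' := by
    rw [Units.val_mul, principal_mul u.ne_zero u'.ne_zero, ofAdd_add]

/-- `principalHom u = ADiv(u)`. [cite: MochizukiGenEll2010, §1 p.4] -/
@[simp] theorem principalHom_apply (u : Fˣ) :
    principalHom u = Multiplicative.ofAdd (principal (u : F)) := rfl

end ADivisor

/-! ### The subgroup `APrc(F)` of principal arithmetic divisors -/

/-- **`APrc(F) ⊆ ADiv(F)`**: the subgroup of principal arithmetic divisors `{ADiv(f) : f ∈ F^×}`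
(realised inside `ADiv_ℝ(F)`). [cite: MochizukiGenEll2010, §1 p.4] -/
def APrc : AddSubgroup (ADivisor F) where
  carrier := {a | ∃ f : F, f ≠ 0 ∧ ADivisor.principal f = a}
  zero_mem' := ⟨1, one_ne_zero, ADivisor.principal_one⟩
  add_mem' := by
    rintro a b ⟨f, hf, rfl⟩ ⟨g, hg, rfl⟩
    exact ⟨f * g, mul_ne_zero hf hg, ADivisor.principal_mul hf hg⟩
  neg_mem' := by
    rintro a ⟨f, hf, rfl⟩
    exact ⟨f⁻¹, inv_ne_zero hf, ADivisor.principal_inv f⟩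

variable {F} in
/-- Membership in `APrc(F)`. [cite: MochizukiGenEll2010, §1 p.4] -/
theorem mem_APrc_iff (a : ADivisor F) : a ∈ APrc F ↔ ∃ f : F, f ≠ 0 ∧ ADivisor.principal f = a :=
  Iff.rfl

variable {F} in
/-- `ADiv(f) ∈ APrc(F)` for `f ≠ 0`. [cite: MochizukiGenEll2010, §1 p.4] -/
theorem principal_mem_APrc {f : F} (hf : f ≠ 0) : ADivisor.principal f ∈ APrc F := ⟨f, hf, rfl⟩

/-! ### The product formula: `deg_F(ADiv(f)) = 0` -/

variable {F} in
/-- **Product formula, logarithmic form over `𝕍(F)`**: for `f ≠ 0` and any finite set `T` of finite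
places containing all `v` with `ord_v(f) ≠ 0`,
`Σ_{v|∞} [F_v:ℝ]·log|f|_v + Σ_{v ∈ T} log‖f‖_v = 0` (`log` of Mathlib's `NumberField.prod_abs_eq_one`,
`∏_{v|∞} |f|_v^{[F_v:ℝ]} · ∏_{v∤∞} ‖f‖_v = 1`). [cite: MochizukiGenEll2010, §1 p.4] -/
theorem sum_mult_log_add_sum_log_adicAbv_eq_zero {f : F} (hf : f ≠ 0)
    {T : Finset (HeightOneSpectrum (𝓞 F))} (hT : {v | ord F v f ≠ 0} ⊆ (T : Set _)) :
    ∑ w : InfinitePlace F, (w.mult : ℝ) * Real.log (w f) +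
      ∑ v ∈ T, Real.log (NumberField.HeightOneSpectrum.adicAbv F v f) = 0 := by
  have hprod := NumberField.prod_abs_eq_one hf
  -- finite places ↔ maximal ideals
  have h1 : ∏ᶠ w : FinitePlace F, w f =
      ∏ᶠ v : HeightOneSpectrum (𝓞 F), NumberField.HeightOneSpectrum.adicAbv F v f := by
    rw [← finprod_comp_equiv FinitePlace.equivHeightOneSpectrum.symm]
    simp only [FinitePlace.equivHeightOneSpectrum_symm_apply, FinitePlace.norm_embedding]
  -- the finprod is a finite product over `T`
  have h2 : ∏ᶠ v : HeightOneSpectrum (𝓞 F), NumberField.HeightOneSpectrum.adicAbv F v f =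
      ∏ v ∈ T, NumberField.HeightOneSpectrum.adicAbv F v f := by
    refine finprod_eq_prod_of_mulSupport_subset _ fun v hv => hT ?_
    rw [Function.mem_mulSupport] at hv
    exact (ord_ne_zero_iff_adicAbv_ne_one F v hf).mpr hv
  rw [h1, h2] at hprod
  have hpos_arch : ∀ w ∈ (Finset.univ : Finset (InfinitePlace F)), (w f : ℝ) ^ w.mult ≠ 0 :=
    fun w _ => pow_ne_zero _ (InfinitePlace.pos_iff.mpr hf).ne'
  have hpos_fin : ∀ v ∈ T, NumberField.HeightOneSpectrum.adicAbv F v f ≠ 0 :=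
    fun v _ => ((NumberField.HeightOneSpectrum.adicAbv F v).pos hf).ne'
  have hA : (∏ w : InfinitePlace F, (w f : ℝ) ^ w.mult) ≠ 0 := Finset.prod_ne_zero_iff.mpr hpos_arch
  have hB : (∏ v ∈ T, NumberField.HeightOneSpectrum.adicAbv F v f) ≠ 0 :=
    Finset.prod_ne_zero_iff.mpr hpos_fin
  have hlog := congrArg Real.log hprod
  rw [Real.log_one, Real.log_mul hA hB, Real.log_prod hpos_arch, Real.log_prod hpos_fin] at hlog
  simpa [Real.log_pow] using hlog

variable {F} in
/-- **Product formula, degree form**: for `f ≠ 0` and `T ⊇ {v : ord_v(f) ≠ 0}` finite,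
`Σ_{v ∈ T} ord_v(f)·log(q_v) = Σ_{v|∞} [F_v:ℝ]·log|f|_v` (since `log‖f‖_v = −ord_v(f)·log(q_v)`).
[cite: MochizukiGenEll2010, §1 p.4] -/
theorem sum_ord_mul_logNorm_eq_sum_mult_log {f : F} (hf : f ≠ 0)
    {T : Finset (HeightOneSpectrum (𝓞 F))} (hT : {v | ord F v f ≠ 0} ⊆ (T : Set _)) :
    ∑ v ∈ T, (ord F v f : ℝ) * logNorm F v = ∑ w : InfinitePlace F, (w.mult : ℝ) * Real.log (w f) := by
  have h := sum_mult_log_add_sum_log_adicAbv_eq_zero hf hT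
  have hv : ∀ v ∈ T, Real.log (NumberField.HeightOneSpectrum.adicAbv F v f) =
      -((ord F v f : ℝ) * logNorm F v) := by
    intro v _
    rw [log_adicAbv_eq_neg_deg F v hf, FinDivisor.deg_of]
  rw [Finset.sum_congr rfl hv, Finset.sum_neg_distrib] at h
  linarith

/-- **`deg_F(ADiv(f)) = 0`** (for every `f`; `f = 0` by the junk convention) — the product formula,
i.e. the printed "the degree map `deg_F : ADiv(F)/APrc(F) → ℝ` … determines a homomorphism".
[cite: MochizukiGenEll2010, §1 p.4] -/
theorem degF_principal (f : F) : degF F (ADivisor.principal f) = 0 := by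
  by_cases hf : f = 0
  · rw [hf, ADivisor.principal_zero, map_zero]
  have hT : {v | ord F v f ≠ 0} ⊆ ((ADivisor.principalNon f).support : Set _) := by
    intro v hv
    simp only [Finset.mem_coe, Finsupp.mem_support_iff, ADivisor.principalNon,
      Finsupp.ofSupportFinite_coe, ne_eq, Int.cast_eq_zero]
    exact hv
  rw [degF_apply, ADivisor.principal, Finsupp.sum_sumElim]
  have harc : (ADivisor.principalArc f).sum (fun w c => c * degWeight F (Sum.inl w)) =
      ∑ w : InfinitePlace F, -((w.mult : ℝ) * Real.log (w f)) := by
    rw [Finsupp.sum_fintype _ _ (fun _ => by simp)]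
    simp [ADivisor.principalArc]
  have hnon : (ADivisor.principalNon f).sum (fun v c => c * degWeight F (Sum.inr v)) =
      ∑ v ∈ (ADivisor.principalNon f).support, (ord F v f : ℝ) * logNorm F v := by
    rw [Finsupp.sum]
    refine Finset.sum_congr rfl fun v _ => ?_
    simp [ADivisor.principalNon, Finsupp.ofSupportFinite_coe]
  change (ADivisor.principalArc f).sum (fun w c => c * degWeight F (Sum.inl w)) +
    (ADivisor.principalNon f).sum (fun v c => c * degWeight F (Sum.inr v)) = 0
  rw [harc, hnon, sum_ord_mul_logNorm_eq_sum_mult_log hf hT, Finset.sum_neg_distrib]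
  ring

/-- Normalised form: `deg(ADiv(f)) = deg_F(ADiv(f))/[F:ℚ] = 0`. [cite: MochizukiGenEll2010, §1 p.4] -/
theorem ndeg_principal (f : F) : ndeg F (ADivisor.principal f) = 0 := by
  rw [ndeg_apply, degF_principal, zero_div]

variable {F} in
/-- `deg_F` vanishes on `APrc(F)`. [cite: MochizukiGenEll2010, §1 p.4] -/
theorem degF_eq_zero_of_mem_APrc {a : ADivisor F} (ha : a ∈ APrc F) : degF F a = 0 := by
  obtain ⟨f, -, rfl⟩ := ha
  exact degF_principal F f

/-- `APrc(F) ≤ ker(deg_F)`. [cite: MochizukiGenEll2010, §1 p.4] -/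
theorem APrc_le_ker_degF : APrc F ≤ (degF F).toAddMonoidHom.ker := fun _ ha =>
  (AddMonoidHom.mem_ker).mpr (degF_eq_zero_of_mem_APrc ha)

/-- **The degree map on `ADiv_ℝ(F)/APrc(F)`** ("determines a homomorphism
`deg_F : ADiv(F)/APrc(F) → ℝ`"): `deg_F` descends to the quotient by the principal divisors.
[cite: MochizukiGenEll2010, §1 p.4] -/
def degFQuot : ADivisor F ⧸ APrc F →+ ℝ :=
  QuotientAddGroup.lift (APrc F) (degF F).toAddMonoidHom (APrc_le_ker_degF F)

/-- `deg_F([𝔞]) = deg_F(𝔞)` on classes. [cite: MochizukiGenEll2010, §1 p.4] -/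
@[simp] theorem degFQuot_mk (a : ADivisor F) :
    degFQuot F (a : ADivisor F ⧸ APrc F) = degF F a :=
  QuotientAddGroup.lift_mk (APrc F) (APrc_le_ker_degF F) a

variable {F} in
/-- Divisors that differ by a principal divisor have the same degree. [cite: MochizukiGenEll2010, §1 p.4] -/
theorem degF_eq_of_sub_mem_APrc {a b : ADivisor F} (h : a - b ∈ APrc F) : degF F a = degF F b := by
  have := degF_eq_zero_of_mem_APrc h
  rw [map_sub] at this
  linarith

/-- `deg_F(𝔞 + ADiv(f)) = deg_F(𝔞)`. [cite: MochizukiGenEll2010, §1 p.4] -/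
theorem degF_add_principal (a : ADivisor F) (f : F) :
    degF F (a + ADivisor.principal f) = degF F a := by
  rw [map_add, degF_principal, add_zero]

/-! ### Pull-back to a finite extension: `ADiv(f)|_K = ADiv(f)` -/

section Pullback

variable (K : Type*) [Field K] [NumberField K] [Algebra F K]

/-- `ord_w(f) = e_{w|v}·ord_v(f)` for `w | v` (Mathlib's `valuation_liesOver`).
[cite: MochizukiGenEll2010, §1 p.4] -/
theorem ord_algebraMap (w : HeightOneSpectrum (𝓞 K)) (f : F) :
    ord K w (algebraMap F K f) =
      Ideal.ramificationIdx' (finBelow F K w).asIdeal w.asIdeal * ord F (finBelow F K w) f := by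
  unfold ord
  rw [← IsDedekindDomain.HeightOneSpectrum.valuation_liesOver K (finBelow F K w) w f,
    WithZero.log_pow]
  ring

omit [NumberField F] [NumberField K] in
/-- `[K_w : ℝ] = [K_w : F_v]·[F_v : ℝ]` at an archimedean `w | v`: `w.mult = m_w·v.mult`.
[cite: MochizukiGenEll2010, §1 p.4] -/
theorem pullbackWeight_mul_mult_comap (w : InfinitePlace K) :
    pullbackWeight F K (Sum.inl w) * (w.comap (algebraMap F K)).mult = w.mult := by
  by_cases h : w.IsUnramified F
  · simp [pullbackWeight, h, h.eq]
  · obtain ⟨hc, hr⟩ := InfinitePlace.not_isUnramified_iff.mp h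
    have hw : ¬ w.IsReal := InfinitePlace.not_isReal_iff_isComplex.mpr hc
    simp [pullbackWeight, h, InfinitePlace.mult, hw, hr]

/-- **Principal divisors pull back to principal divisors**: `ADiv(f)|_K = ADiv(f)` (the `f` on the
right viewed in `K`). [cite: MochizukiGenEll2010, §1 p.4] -/
theorem pullback_principal (f : F) :
    (ADivisor.principal f).pullback F K = ADivisor.principal (algebraMap F K f) := by
  ext (w | w)
  · rw [ADivisor.pullback_apply, ADivisor.principal_apply_inl]
    change _ * ADivisor.principal f (Sum.inl (w.comap (algebraMap F K))) = _
    rw [ADivisor.principal_apply_inl, InfinitePlace.comap_apply, ← pullbackWeight_mul_mult_comap F K w]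
    push_cast
    ring
  · rw [ADivisor.pullback_apply, ADivisor.principal_apply_inr]
    change _ * ADivisor.principal f (Sum.inr (finBelow F K w)) = _
    rw [ADivisor.principal_apply_inr, ord_algebraMap F K w f]
    simp only [pullbackWeight]
    push_cast
    ring

variable {F K} in
/-- `APrc(F)|_K ⊆ APrc(K)`: the pull-back of a principal divisor is principal, so `𝔞 ↦ 𝔞|_K` descends
to the class groups `ADiv(F)/APrc(F) → ADiv(K)/APrc(K)`. [cite: MochizukiGenEll2010, §1 p.4] -/
theorem pullback_mem_APrc {a : ADivisor F} (ha : a ∈ APrc F) : a.pullback F K ∈ APrc K := by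
  obtain ⟨f, hf, rfl⟩ := ha
  exact ⟨algebraMap F K f, (map_ne_zero _).mpr hf, (pullback_principal F K f).symm⟩

end Pullback

end Literature.IUT.LogVolume

end
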